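import Summits.CriticalPhenomena.PercolationContinuityZ3.Theorems.NearLinearTwoClusterDecay.Negative.AspectRenorm
import Summits.CriticalPhenomena.PercolationContinuityZ3.Theorems.PercNonProliferationSubpolynomialBlockingStubCritAnnulusCrossingPos
import Literature.Probability.Percolation.HalfSpaceBGN
import HarnessLib

/-!
# Critical crossing positivity at EVERY bounded aspect on `ℤ³` (vdBvE programme, brick V2)

Negative-side structure for the crux `NearLinearTwoClusterDecay` (stmt-CriticalPhenomena-5785), line
`critical-orange-peeling`, lead seat c2.  Write `u_M(n) = P_p(cross(n, Mn))` for the probability that the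
inner box `Λ(n)` is joined to `∂ⁱⁿΛ(Mn)` by an open path inside `Λ(Mn)` (bond percolation on `ℤ³`).

* `aspectCrossing_pos` (registered stub): GIVEN the aspect-`M` renormalisation inequality
  `u_M(20n) ≤ ((100M)³ u_M(n))²` (the landed `aspectCrossing_renorm`, taken verbatim as hypothesis), for
  every `M ≥ 2` there is `c(M) > 0` with `c ≤ u_M(n)` at `p = p_c(ℤ³)` for ALL `n ≥ 1`.
* `critAspectCrossing_pos` : the unconditional corollary (hypothesis discharged by `aspectCrossing_renorm`).

This is the "classical argument going back to Kesten (1981)" invoked by van den Berg–van Engelenburg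
(arXiv:2009.13337, proof of Prop. 2: "the probability that there is such an open path is larger than
some constant `ε̃(M,d) > 0`"): otherwise some `u_M(m)(p_c) < (100M)^{-6}`; by continuity of
`p ↦ u_M(m)(p)` (a local event of `Λ(Mm)`) and `p_c < 1` the same holds at some `p > p_c`, and iterating
the renormalisation inequality drives `u_M(20^k m)(p) → 0` doubly exponentially, contradicting
`0 < θ(p) ≤ u_M(N)(p)` for all `N` (`StubCritAnnulusCrossingPos.no_small_scale`, reused from the aspect-2
case `critAnnulusCrossing_pos` of crux stmt-4446).
-/

noncomputable section

namespace Summit.CriticalPhenomena.PercolationContinuityZ3.Theorems.NearLinearTwoClusterDecay.Negative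

open MeasureTheory Filter Topology
open Literature.Probability.LatticeModels Literature.Probability.Percolation
open Literature.Probability.Percolation.DCT16
open Summit.CriticalPhenomena.PercolationContinuityZ3.Theorems.SubpolynomialBlocking

namespace AspectCrossingPos

/-- The aspect-`M` crossing event of scale `n` is determined by the pairs inside `Λ(Mn)`. -/
theorem determinedBy_cross (n m : ℕ) :
    DeterminedBy {ω : BondConfig (Site 3) | ∃ x ∈ box 3 n, ∃ y ∈ innerBoundary (zdGraph 3) (box 3 m),
        ω ∈ openConnIn (↑(box 3 m) : Set (Site 3)) x y} (↑(box 3 m).sym2 : Set (Sym2 (Site 3))) := by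
  have h := PlanarDuality.determinedBy_openCrossing (box 3 m) (↑(box 3 n) : Set (Site 3))
    (↑(innerBoundary (zdGraph 3) (box 3 m)) : Set (Site 3))
  convert h using 2 with ω
  simp only [openCrossing, Finset.mem_coe]

/-- `p ↦ u_M(n)(p)` is continuous (a local event of the finite box `Λ(Mn)`). -/
theorem continuous_cross (n m : ℕ) :
    Continuous fun p : unitInterval => (bondPercolation (zdGraph 3) p).real
      {ω : BondConfig (Site 3) | ∃ x ∈ box 3 n, ∃ y ∈ innerBoundary (zdGraph 3) (box 3 m),
        ω ∈ openConnIn (↑(box 3 m) : Set (Site 3)) x y} :=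
  continuous_bondPercolation_real_of_determinedBy (zdGraph 3) (determinedBy_cross n m)

/-- `θ(p) ≤ u_M(n)(p)`: the one-arm event of the origin at radius `Mn` is a crossing from `Λ(n)`. -/
theorem theta_le_real_cross (p : unitInterval) (n m : ℕ) :
    theta (zdGraph 3) (0 : Site 3) p ≤ (bondPercolation (zdGraph 3) p).real
      {ω : BondConfig (Site 3) | ∃ x ∈ box 3 n, ∃ y ∈ innerBoundary (zdGraph 3) (box 3 m),
        ω ∈ openConnIn (↑(box 3 m) : Set (Site 3)) x y} := by
  refine (theta_le_real_siteToBoundary p m).trans (measureReal_mono ?_)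
  rintro ω ⟨y, hy, hω⟩
  exact ⟨0, zero_mem_box 3 n, y, hy, hω⟩

end AspectCrossingPos

/-- **Registered stub `aspectCrossing_pos` (vdBvE programme V2): critical crossing positivity at every
bounded aspect.** If `u_M(20n) ≤ ((100M)³ u_M(n))²` for all `M ≥ 2`, `p`, `n ≥ 1`
(`u_M(n) = P_p(Λ(n) ⟷ ∂ⁱⁿΛ(Mn) in Λ(Mn))` on `ℤ³`), then for every `M ≥ 2` there is `c > 0` with
`c ≤ u_M(n)` at `p_c(ℤ³)` for all `n ≥ 1`.
[cite: VandenbergVanengelenburg2022, proof of Prop. 2 (the constant `ε̃(M,d)`, "a classical argument going back to Kesten 1981")] -/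
theorem aspectCrossing_pos
    (hren : ∀ (M : ℕ) (p : unitInterval) (n : ℕ), 2 ≤ M → 1 ≤ n →
      (bondPercolation (zdGraph 3) p).real
          {ω | ∃ x ∈ box 3 (20 * n), ∃ y ∈ innerBoundary (zdGraph 3) (box 3 (M * (20 * n))),
            ω ∈ openConnIn (↑(box 3 (M * (20 * n))) : Set (Site 3)) x y} ≤
        (((100 : ℝ) * M) ^ 3 * (bondPercolation (zdGraph 3) p).real
          {ω | ∃ x ∈ box 3 n, ∃ y ∈ innerBoundary (zdGraph 3) (box 3 (M * n)),
            ω ∈ openConnIn (↑(box 3 (M * n)) : Set (Site 3)) x y}) ^ 2) :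
    ∀ M : ℕ, 2 ≤ M → ∃ c : ℝ, 0 < c ∧ ∀ n : ℕ, 1 ≤ n →
      c ≤ (bondPercolation (zdGraph 3) (criticalProbI 3)).real
        {ω | ∃ x ∈ box 3 n, ∃ y ∈ innerBoundary (zdGraph 3) (box 3 (M * n)),
          ω ∈ openConnIn (↑(box 3 (M * n)) : Set (Site 3)) x y} := by
  intro M hM
  have hK : (0 : ℝ) < ((100 : ℝ) * M) ^ 3 := by positivity
  by_contra hcon
  push Not at hcon
  obtain ⟨m, hm, hsmall⟩ := hcon (1 / (((100 : ℝ) * M) ^ 3) ^ 2) (by positivity)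
  -- a supercritical `p > p_c` at which scale `m` is still small
  obtain ⟨p, hpc, hpm⟩ := StubCritAnnulusCrossingPos.exists_gt_of_continuous
    (AspectCrossingPos.continuous_cross m (M * m)) (p₀ := criticalProbI 3)
    (by rw [coe_criticalProbI]; exact criticalProb_zd_lt_one (by norm_num)) hsmall
  have hθ : 0 < theta (zdGraph 3) (0 : Site 3) p :=
    theta_pos_of_criticalProb_lt_holds (zdGraph 3) (0 : Site 3) p (by
      have := hpc; rwa [coe_criticalProbI] at this)
  refine StubCritAnnulusCrossingPos.no_small_scale
    (a := fun n => (bondPercolation (zdGraph 3) p).real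
      {ω | ∃ x ∈ box 3 n, ∃ y ∈ innerBoundary (zdGraph 3) (box 3 (M * n)),
        ω ∈ openConnIn (↑(box 3 (M * n)) : Set (Site 3)) x y})
    hK hθ (fun n => measureReal_nonneg)
    (fun n _ => AspectCrossingPos.theta_le_real_cross p n (M * n)) (fun n hn => hren M p n hM hn) hm hpm

/-- **Critical crossing positivity at every bounded aspect on `ℤ³`, unconditionally**: for every `M ≥ 2`
there is `c(M) > 0` with `c ≤ P_{p_c}(Λ(n) ⟷ ∂ⁱⁿΛ(Mn) in Λ(Mn))` for all `n ≥ 1`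
(`aspectCrossing_pos` with its hypothesis discharged by the landed `aspectCrossing_renorm`).
[cite: VandenbergVanengelenburg2022, proof of Prop. 2 (the constant `ε̃(M,d)`)] -/
theorem critAspectCrossing_pos : ∀ M : ℕ, 2 ≤ M → ∃ c : ℝ, 0 < c ∧ ∀ n : ℕ, 1 ≤ n →
    c ≤ (bondPercolation (zdGraph 3) (criticalProbI 3)).real
      {ω | ∃ x ∈ box 3 n, ∃ y ∈ innerBoundary (zdGraph 3) (box 3 (M * n)),
        ω ∈ openConnIn (↑(box 3 (M * n)) : Set (Site 3)) x y} :=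
  aspectCrossing_pos aspectCrossing_renorm

end Summit.CriticalPhenomena.PercolationContinuityZ3.Theorems.NearLinearTwoClusterDecay.Negative

end
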